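import Summits.AtomisticToContinuum.HydrodynamicLimit.Theorems.MourreKoopmanChargesLinearToEntropyInBandDefsC
import Literature.Analysis.FunctionSpaces.PoissonMeckePrelims
import Mathlib.Probability.Kernel.Disintegration.StandardBorel
import Mathlib.Probability.Kernel.Composition.MeasureComp
import HarnessLib

/-!
# Route `MourreKoopmanCharges` — posited objects of the crux line for `LinearToEntropyInBand`, part D:
# ball contents and the splice law

§ 5 of the objects module of the crux `MourreKoopmanCharges.LinearToEntropyInBand`
(stmt-AtomisticToContinuum-17740, line `registered`), skeleton v8 (lead prover-line-…-17740-c5-0, wave 4 of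
2026-08-17): the TYPE of ball restrictions and the SPLICE of the ball-wise localisation of stub 4a-i
`stub_visibleOneBlockEstimateInBand` (architecture audit AUDIT-4a § 3, items 0–1; sizing memo
`VOBE-DECOMPOSITION` § 0–1).  Parts A–C (`…Defs`, `…DefsB`, `…DefsC`) are imported, never modified.  New here
(definitions, `Prop`-valued instances and the `rfl`-grade registered bookkeeping stub (m) only; every theorem
about them lives in the companion proof file `…LinearToEntropyInBandBallContent`):

* (i) `instStandardBorelSpaceConfig` — labelled torus phase space `Config n (Fin 3) T3 = (Fin n → 𝕋³ × ℝ³)` is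
  standard Borel.  This is Mathlib's `StandardBorelSpace.pi_countable`; instance search does not find it through
  the nested pi type `Fin n → (Fin 3 → AddCircle 1) × _`, and `Measure.condKernel` (target standard Borel) needs
  it in (l).  (Plus the re-keyed finiteness instances `instIsFiniteMeasureBallMarginal/BallJoint`.)
* (j) `instMeasurableEqPointConfig` — the count σ-algebra of locally finite configurations `PointConfig E` in a
  second countable Hausdorff space has a MEASURABLE DIAGONAL: configurations are closed
  (`PointConfig.isClosed_carrier`), so two configurations with equal counts on a countable topological basis
  coincide, and the diagonal is a countable intersection of the measurable sets `{N_c(U) = N_d(U)}`.  It makes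
  the graph of any measurable map into configurations measurable (`measurableSet_eq_fun`), which the entropy
  identity of the splice (`klDiv_condKernel_comp_eq'` of `…SpliceCore`) consumes.
* (k) `ballContent B z : PointConfig (T3 × V3)` — the UNLABELLED phase-space content of the labelled
  configuration `z` over the region `B ⊆ 𝕋³`: the tree's `PointConfig.ofFn z` (set of values of the tuple)
  restricted to the window `B ×ˢ univ` (`PointConfig.restrict`).  Label-free, so that the `N`-system
  (`Config (N+1) …`) and the `M_B`-systems (`Cfg M_B`) have ball contents of ONE type; `ballMarginal B μ` is the
  image law.
* (l) `ballJoint B G` (graph law `G ∘ (ballContent B, id)⁻¹`) and `spliceLaw B f G` — the law on the `m`-system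
  whose ball content is distributed as `f|_B` and which is `G` conditionally on the ball content:
  `(ballJoint B G).condKernel ∘ₘ ballMarginal B f` (Mathlib's `Measure.condKernel`, `Measure.bind`).  Its two
  identities — `(spliceLaw B f G)|_B = f|_B` and `KL(spliceLaw B f G ‖ G) = KL(f|_B ‖ G|_B)`, both under
  `f|_B ≪ G|_B` — are the specialisations of the landed `…SpliceCore` proved in the companion file.
* (m) the registered bookkeeping stub `stub_objectsBallContent` (unfolding identities of (k)–(l); sorry-free).

Lean conventions (documented junk): COINCIDENT labelled phase points merge into one point of the set-valued
`ballContent` (a Liouville-null event, invisible under every law of the line, all absolutely continuous);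
`ballMarginal B μ = 0` for non-measurable `B` (Mathlib's `Measure.map` of a non-a.e.-measurable map);
`spliceLaw B f G = 0` unless `G` is a finite measure, and off the support of `G|_B` the conditional kernel is
Mathlib's arbitrary choice — so every statement about the splice carries the hypothesis `f|_B ≪ G|_B`, which for
the profile reference `ψ` of the line against the frozen homogeneous law `G_{M_B}` holds only AFTER truncation of
the ball counts (overflow counts `> M_B + 1` have positive `ψ`-probability; memo § 1).  Nothing here restates the
crux, the route's items or the Statement; no named fact is introduced.  References (folklore): Kingman,
*Poisson Processes* (1993) § 2.1 (count σ-algebra); Kallenberg, *Foundations of Modern Probability* (2002)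
Thm 6.3–6.4 (disintegration); Yau, Lett. Math. Phys. 22 (1991) § 2 (relative entropy method, local marginals).
-/

noncomputable section

open MeasureTheory Filter Set ProbabilityTheory
open scoped ENNReal Topology

namespace Summit.AtomisticToContinuum.HydrodynamicLimit.Theorems.LTEInBand

open Literature.MathematicalPhysics.KineticTheory Literature.Analysis.FluidPDE Literature.Analysis.FunctionSpaces

/-! ## § 5 Ball contents and the splice law (objects of AUDIT-4a § 3 items 0–1) -/

/-! ### (i)–(j) Two `Prop`-valued instances on the ambient spaces -/

/-- **(i)** Labelled torus phase space `Config n (Fin 3) T3 = (Fin n → 𝕋³ × ℝ³)` is standard Borel — Mathlib's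
`StandardBorelSpace.pi_countable` over the standard Borel factor `T3 × V3`, stated for the abbreviation because
instance search does not find it through the nested pi type (needed by `Measure.condKernel` in `spliceLaw`).
`Prop`-valued: no data, no diamond. [folklore] -/
instance instStandardBorelSpaceConfig (n : ℕ) : StandardBorelSpace (Config n (Fin 3) T3) :=
  @StandardBorelSpace.pi_countable (Fin n) _ (fun _ => T3 × V3) _ fun _ => inferInstance

/-- **(j) The count σ-algebra of locally finite configurations in a second countable Hausdorff space has a
measurable diagonal** (`MeasurableEq (PointConfig E)`): two configurations with the same counts on a countable
topological basis coincide (configurations are closed, `PointConfig.isClosed_carrier`, so a point of `c` off `d`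
has a basic neighbourhood `U` missing `d`, where `N_c(U) ≠ 0 = N_d(U)`), hence the diagonal is the countable
intersection of the measurable sets `{N_c(U) = N_d(U)}` (`ℕ∞` is countable with measurable singletons).  Used
through `measurableSet_eq_fun` for the graph of the ball-content map (`klDiv_condKernel_comp_eq'`).  Kingman,
*Poisson Processes* (1993) § 2.1; Last–Penrose (2017) § 2.1. [folklore] -/
instance instMeasurableEqPointConfig {E : Type*} [TopologicalSpace E] [T2Space E]
    [SecondCountableTopology E] [MeasurableSpace E] [OpensMeasurableSpace E] :
    MeasurableEq (PointConfig E) := by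
  constructor
  obtain ⟨b, hbc, -, hb⟩ := TopologicalSpace.exists_countable_basis E
  -- equal counts on the basis force inclusion of carriers
  have hsub : ∀ c d : PointConfig E, (∀ U ∈ b, c.count U = d.count U) → ∀ x ∈ c, x ∈ d := by
    intro c d h x hxc
    by_contra hxd
    obtain ⟨U, hUb, hxU, hUd⟩ :=
      hb.exists_subset_of_mem_open (show x ∈ (d : Set E)ᶜ from hxd) d.isClosed_carrier.isOpen_compl
    have h0 : d.count U = 0 := by
      rw [PointConfig.count, Set.encard_eq_zero, Set.eq_empty_iff_forall_notMem]
      exact fun y hy => hUd hy.2 hy.1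
    have h1 : c.count U ≠ 0 := by
      rw [PointConfig.count, Ne, Set.encard_eq_zero, ← Ne, ← Set.nonempty_iff_ne_empty]
      exact ⟨x, hxc, hxU⟩
    exact h1 ((h U hUb).trans h0)
  have key : Set.diagonal (PointConfig E) =
      ⋂ U ∈ b, {p : PointConfig E × PointConfig E | p.1.count U = p.2.count U} := by
    ext ⟨c, d⟩
    simp only [Set.mem_diagonal_iff, Set.mem_iInter, Set.mem_setOf_eq]
    refine ⟨fun h U _ => by rw [h], fun h => PointConfig.ext fun x => ⟨hsub c d h x, ?_⟩⟩
    exact hsub d c (fun U hU => (h U hU).symm) x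
  rw [key]
  exact MeasurableSet.biInter hbc fun U hU =>
    measurableSet_eq_fun ((PointConfig.measurable_count (hb.isOpen hU).measurableSet).comp measurable_fst)
      ((PointConfig.measurable_count (hb.isOpen hU).measurableSet).comp measurable_snd)

/-! ### (k) Ball contents and ball marginals -/

/-- **(k) Ball content** of a labelled torus configuration `z = (xᵢ, vᵢ)_{i<n}`: the finite (hence locally finite)
SET of phase points `(xᵢ, vᵢ)` with `xᵢ ∈ B`, as an unlabelled configuration `PointConfig (T3 × V3)` — the
tree's `PointConfig.ofFn z` (the set of values of the tuple) restricted to the window `B ×ˢ univ`.  Label-free so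
that the `N`-system and the `M_B`-systems have ball contents of ONE type.  Documented junk: COINCIDENT labelled
phase points merge into one point of the set (a Liouville-null event, invisible under every law of the line,
all absolutely continuous). -/
def ballContent (B : Set T3) {n : ℕ} (z : Config n (Fin 3) T3) : PointConfig (T3 × V3) :=
  (PointConfig.ofFn z).restrict (B ×ˢ Set.univ)

/-- **Ball marginal** `μ|_B` of a law `μ` on labelled `n`-configurations: the image of `μ` under the ball-content
map, a law on unlabelled phase-space configurations. -/
def ballMarginal (B : Set T3) {n : ℕ} (μ : Measure (Config n (Fin 3) T3)) : Measure (PointConfig (T3 × V3)) :=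
  μ.map (ballContent B)

/-- The ball marginal of a finite law is finite (Mathlib's `Measure.isFiniteMeasure_map`, re-keyed on the
definition `ballMarginal`, which instance search does not unfold). [folklore] -/
instance instIsFiniteMeasureBallMarginal (B : Set T3) {n : ℕ} (μ : Measure (Config n (Fin 3) T3))
    [IsFiniteMeasure μ] : IsFiniteMeasure (ballMarginal B μ) :=
  Measure.isFiniteMeasure_map μ _

/-! ### (l) The graph law and the splice law -/

/-- **(l)** The **graph law** `G ∘ (ballContent B, id)⁻¹` of a law `G` on labelled `m`-configurations — the joint law of
(ball content, configuration), to be disintegrated along the first coordinate. -/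
def ballJoint (B : Set T3) {m : ℕ} (G : Measure (Config m (Fin 3) T3)) :
    Measure (PointConfig (T3 × V3) × Config m (Fin 3) T3) :=
  G.map fun z => (ballContent B z, z)

/-- The graph law of a finite law is finite (Mathlib's `Measure.isFiniteMeasure_map`, re-keyed on the definition
`ballJoint`; it is the `[IsFiniteMeasure]` argument of `Measure.condKernel` in `spliceLaw`). [folklore] -/
instance instIsFiniteMeasureBallJoint (B : Set T3) {m : ℕ} (G : Measure (Config m (Fin 3) T3))
    [IsFiniteMeasure G] : IsFiniteMeasure (ballJoint B G) :=
  Measure.isFiniteMeasure_map G _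

/-- **The splice law** `spliceLaw B f G` (`BallSplice` of AUDIT-4a § 3 item 1): the law on labelled
`m`-configurations whose ball content is distributed as the ball marginal `f|_B` of a law `f` on
`n`-configurations and which, CONDITIONALLY on the ball content, is `G` — Mathlib's conditional kernel
`(ballJoint B G).condKernel` of the graph law (target standard Borel) composed with the new marginal,
`(ballJoint B G).condKernel ∘ₘ ballMarginal B f`.  Meaningful only when `f|_B ≪ G|_B` (off the support of `G|_B`
the conditional kernel is arbitrary); documented junk `0` when `G` is not a finite measure. -/
def spliceLaw (B : Set T3) {n m : ℕ} (f : Measure (Config n (Fin 3) T3)) (G : Measure (Config m (Fin 3) T3)) :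
    Measure (Config m (Fin 3) T3) :=
  open scoped Classical in
  if h : IsFiniteMeasure G then
    haveI := h
    (ballJoint B G).condKernel ∘ₘ ballMarginal B f
  else 0

/-! ### (m) The registered bookkeeping stub -/

/-- **(m) Registered bookkeeping stub `stub_objectsBallContent` of skeleton v8** (objects part D): the unfolding
identities of (k)–(l) in the fully applied form the companion proof file and the later items of 4a-i consume —
the ball content is the set `range z ∩ B ×ˢ univ`, the ball marginal and the graph law are image laws, and for a
finite reference `G` the splice law is `(ballJoint B G).condKernel ∘ₘ ballMarginal B f`.  Sorry-free (`rfl` and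
`dif_pos`). -/
theorem stub_objectsBallContent : (∀ (B : Set Literature.MathematicalPhysics.KineticTheory.T3) (n : ℕ) (z : Literature.Analysis.FluidPDE.Config n (Fin 3) Literature.MathematicalPhysics.KineticTheory.T3), (Summit.AtomisticToContinuum.HydrodynamicLimit.Theorems.LTEInBand.ballContent B z : Set (Literature.MathematicalPhysics.KineticTheory.T3 × Literature.MathematicalPhysics.KineticTheory.V3)) = Set.range z ∩ B ×ˢ Set.univ) ∧ (∀ (B : Set Literature.MathematicalPhysics.KineticTheory.T3) (n : ℕ) (μ : MeasureTheory.Measure (Literature.Analysis.FluidPDE.Config n (Fin 3) Literature.MathematicalPhysics.KineticTheory.T3)), Summit.AtomisticToContinuum.HydrodynamicLimit.Theorems.LTEInBand.ballMarginal B μ = μ.map (Summit.AtomisticToContinuum.HydrodynamicLimit.Theorems.LTEInBand.ballContent B)) ∧ (∀ (B : Set Literature.MathematicalPhysics.KineticTheory.T3) (m : ℕ) (G : MeasureTheory.Measure (Literature.Analysis.FluidPDE.Config m (Fin 3) Literature.MathematicalPhysics.KineticTheory.T3)), Summit.AtomisticToContinuum.HydrodynamicLimit.Theorems.LTEInBand.ballJoint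 B G = G.map fun z => (Summit.AtomisticToContinuum.HydrodynamicLimit.Theorems.LTEInBand.ballContent B z, z)) ∧ (∀ (B : Set Literature.MathematicalPhysics.KineticTheory.T3) (n m : ℕ) (f : MeasureTheory.Measure (Literature.Analysis.FluidPDE.Config n (Fin 3) Literature.MathematicalPhysics.KineticTheory.T3)) (G : MeasureTheory.Measure (Literature.Analysis.FluidPDE.Config m (Fin 3) Literature.MathematicalPhysics.KineticTheory.T3)) [MeasureTheory.IsFiniteMeasure G], Summit.AtomisticToContinuum.HydrodynamicLimit.Theorems.LTEInBand.spliceLaw B f G = MeasureTheory.Measure.bind (Summit.AtomisticToContinuum.HydrodynamicLimit.Theorems.LTEInBand.ballMarginal B f) ⇑(Summit.AtomisticToContinuum.HydrodynamicLimit.Theorems.LTEInBand.ballJoint B G).condKernel) :=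
  ⟨fun _ _ _ => rfl, fun _ _ _ => rfl, fun _ _ _ => rfl, fun B _ _ f G hG => by rw [spliceLaw, dif_pos hG]⟩

end Summit.AtomisticToContinuum.HydrodynamicLimit.Theorems.LTEInBand

end
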